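import Mathlib.Data.ZMod.Basic
import Mathlib.Algebra.BigOperators.Group.Finset.Powerset
import Mathlib.Algebra.BigOperators.Ring.Finset
import Mathlib.Tactic.Ring
import Mathlib.Tactic.Abel
import HarnessLib

/-!
# Local Boolean functions vanishing on a parity class are multiples of parity

**Source.** C. Carlet, *Boolean Functions for Cryptography and Coding Theory*, CUP 2020, §2.2.1 Theorem 1,
eq. (2.4) and its proof (p. 47): the binary Möbius transform `a_I = ⊕_{supp x ⊆ I} f(x)` inverts the ANF
expansion `f(x) = ⊕_{I ⊆ supp x} a_I`; over `𝔽₂` the transform is an involution [Carlet2020].  That statement is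
`moeb_moeb` below (sets instead of vectors: a Boolean function is `f : Finset ι → ZMod 2`).

**Supplied here** (consequences, fully proved; abstract form of the «window-local» lemma used with
`ModThreeTestRelations` in the `AdviceFreeQNC0` cell).  Fix a predicate `loc` of «local» sets (think: subsets of a
window of `w` consecutive coins on a long ring) and a parity `π`.  For `f` whose Möbius coefficients vanish off the
local sets and which vanishes on the parity class `{T : |T| ≡ π}`:
* `moeb_singleton_eq_of_witness`: two singleton coefficients `a_{k}`, `a_{k'}` agree as soon as some local `S` of
  parity `π` avoiding `k, k'` has no local subset of `S ∪ {k,k'}` through `k` or `k'` other than `{k}`, `{k'}`;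
* `eq_mul_parity_of_local`: if `loc` is down-closed with `loc ∅`, every local `S` has an «isolating» element `k`
  (the only local subset of `S ∪ {k}` through `k` is `{k}`), and all singleton coefficients equal `α`, then
  `f T = α · (|T| + π)` for EVERY `T`, i.e. `f = α · (PARITY + π)`.
On a ring of `Q ≥ 2w + 1` coins with `loc` = «inside `w` consecutive coins» the hypotheses hold (isolating element:
a coin at distance `≥ w`; witnesses: far coins), which is how the cell uses it; that instantiation is not done here.

WHAT THIS IS NOT: no geometry (rings/windows) is fixed here; no statement about `MOD₃` tests; no named facts,
no `sorry`.
-/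

namespace Literature.Computability.MetaComplexity

namespace ParityClassLocal

open Finset

variable {ι : Type*} [DecidableEq ι]

/-! ### 1. The binary Möbius transform on set functions -/

/-- The binary Möbius transform `(moeb f)(S) = ⊕_{R ⊆ S} f(R)` (ANF coefficients of `f`, and conversely).
[cite: Carlet2020, §2.2.1 Theorem 1 eq. (2.4)] -/
def moeb (f : Finset ι → ZMod 2) (S : Finset ι) : ZMod 2 := ∑ R ∈ S.powerset, f R

/-- `x + x = 0` in `𝔽₂`. [folklore] -/
private theorem add_self_zmod2 (x : ZMod 2) : x + x = 0 := by revert x; decide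

/-- `x + y = 0 → x = y` in `𝔽₂`. [folklore] -/
private theorem eq_of_add_eq_zero {x y : ZMod 2} (h : x + y = 0) : x = y := by
  revert x y; decide

omit [DecidableEq ι] in
/-- The transform at `∅`. [folklore] -/
private theorem moeb_empty (f : Finset ι → ZMod 2) : moeb f ∅ = f ∅ := by
  simp [moeb]

/-- Splitting the transform at an inserted element. [folklore] -/
private theorem moeb_insert (f : Finset ι → ZMod 2) {a : ι} {S : Finset ι} (h : a ∉ S) :
    moeb f (insert a S) = moeb f S + moeb (fun R => f (insert a R)) S := by
  unfold moeb; rw [sum_powerset_insert h]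

/-- **The binary Möbius transform is an involution** (ANF ↔ truth table over `𝔽₂`).
[cite: Carlet2020, §2.2.1 Theorem 1 eq. (2.4) and its proof] -/
theorem moeb_moeb (f : Finset ι → ZMod 2) (S : Finset ι) : moeb (moeb f) S = f S := by
  induction S using Finset.induction_on generalizing f with
  | empty => rw [moeb_empty, moeb_empty]
  | @insert a S ha ih =>
    rw [moeb_insert _ ha, ih]
    have hsplit : moeb (fun R => moeb f (insert a R)) S =
        moeb (moeb f) S + moeb (moeb fun T => f (insert a T)) S := by
      unfold moeb
      rw [← sum_add_distrib]
      refine sum_congr rfl fun R hR => ?_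
      have haR : a ∉ R := fun h => ha (mem_powerset.1 hR h)
      dsimp only
      rw [sum_powerset_insert haR]
    rw [hsplit, ih, ih, ← add_assoc, add_self_zmod2, zero_add]

/-- The transform at a singleton. [folklore] -/
private theorem moeb_singleton (f : Finset ι → ZMod 2) (k : ι) : moeb f {k} = f ∅ + f {k} := by
  have : ({k} : Finset ι) = insert k ∅ := rfl
  rw [this, moeb_insert f (by simp), moeb_empty, moeb_empty]

omit [DecidableEq ι] in
/-- A transform over `S` of a function supported (inside `S.powerset`) only at `∅`. [folklore] -/
private theorem moeb_eq_apply_empty (g : Finset ι → ZMod 2) (S : Finset ι)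
    (h : ∀ R, R ⊆ S → R ≠ ∅ → g R = 0) : moeb g S = g ∅ := by
  unfold moeb
  rw [sum_eq_single ∅]
  · intro R hR hne; exact h R (mem_powerset.1 hR) hne
  · intro h0; exact absurd (empty_mem_powerset S) h0

/-! ### 2. Equality of singleton coefficients across a witness -/

/-- **Singleton coefficients agree across a far witness.**  Let the Möbius coefficients of `f` vanish off the
`loc` sets and let `f` vanish on the parity class `π`.  If `S` is a set of parity `π` avoiding `k ≠ k'` such that
every `loc` subset of `S ∪ {k, k'}` through `k` or `k'` is `{k}` or `{k'}`, then `a_{k} = a_{k'}`.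
[cite: Carlet2020, §2.2.1 Theorem 1 eq. (2.4) (Möbius inversion; consequence supplied here)] -/
theorem moeb_singleton_eq_of_witness (f : Finset ι → ZMod 2) (loc : Finset ι → Prop) (π : ℕ)
    (hloc : ∀ S, ¬ loc S → moeb f S = 0) (hvan : ∀ T : Finset ι, (T.card : ZMod 2) = π → f T = 0)
    {k k' : ι} (hkk : k ≠ k') (S : Finset ι) (hkS : k ∉ S) (hk'S : k' ∉ S)
    (hS : (S.card : ZMod 2) = π)
    (hw : ∀ R, loc R → R ⊆ insert k (insert k' S) → (k ∈ R ∨ k' ∈ R) → (R = {k} ∨ R = {k'})) :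
    moeb f {k} = moeb f {k'} := by
  set a := moeb f with ha
  have hkS' : k ∉ insert k' S := by
    rw [mem_insert]; rintro (h | h); exact hkk h; exact hkS h
  -- `f` at the witness set and at `S` vanishes
  have h1 : f (insert k (insert k' S)) = 0 := by
    refine hvan _ ?_
    rw [card_insert_of_notMem hkS', card_insert_of_notMem hk'S, Nat.cast_add, Nat.cast_add, hS, Nat.cast_one,
      add_assoc, add_self_zmod2, add_zero]
  have h2 : f S = 0 := hvan S hS
  -- expand by Möbius inversion
  rw [← moeb_moeb f (insert k (insert k' S)), moeb_insert _ hkS', moeb_insert _ hk'S, moeb_insert _ hk'S,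
    moeb_moeb, h2, zero_add] at h1
  -- the three remaining transforms collapse to `a {k'}`, `a {k}`, `0`
  have e1 : moeb (fun R => a (insert k' R)) S = a {k'} := by
    rw [moeb_eq_apply_empty]
    · rfl
    · intro R hRS hne
      refine hloc _ fun hl => hne ?_
      rcases hw _ hl ((insert_subset_insert k' hRS).trans (subset_insert k _))
          (Or.inr (mem_insert_self _ _)) with h | h
      · exact absurd (h ▸ mem_insert_self k' R : k' ∈ ({k} : Finset ι)) (by simpa using hkk.symm)
      · exact eq_empty_of_forall_notMem fun r hr => by
          have : r ∈ ({k'} : Finset ι) := h ▸ mem_insert_of_mem hr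
          rw [mem_singleton] at this; exact hk'S (this ▸ hRS hr)
  have e2 : moeb (fun R => a (insert k R)) S = a {k} := by
    rw [moeb_eq_apply_empty]
    · rfl
    · intro R hRS hne
      refine hloc _ fun hl => hne ?_
      rcases hw _ hl (insert_subset_insert k (hRS.trans (subset_insert _ _)))
          (Or.inl (mem_insert_self _ _)) with h | h
      · exact eq_empty_of_forall_notMem fun r hr => by
          have : r ∈ ({k} : Finset ι) := h ▸ mem_insert_of_mem hr
          rw [mem_singleton] at this; exact hkS (this ▸ hRS hr)
      · exact absurd (h ▸ mem_insert_self k R : k ∈ ({k'} : Finset ι)) (by simpa using hkk)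
  have e3 : moeb (fun R => a (insert k (insert k' R))) S = 0 := by
    unfold moeb
    refine sum_eq_zero fun R hR => hloc _ fun hl => ?_
    have hRS : R ⊆ S := mem_powerset.1 hR
    rcases hw _ hl (insert_subset_insert k (insert_subset_insert k' hRS)) (Or.inl (mem_insert_self _ _))
      with h | h
    · have : k' ∈ ({k} : Finset ι) := h ▸ mem_insert_of_mem (mem_insert_self k' R)
      exact hkk.symm (by simpa using this)
    · have : k ∈ ({k'} : Finset ι) := h ▸ mem_insert_self k _
      exact hkk (by simpa using this)
  rw [e1, e2, e3, add_zero] at h1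
  exact (eq_of_add_eq_zero h1).symm

/-! ### 3. Local functions vanishing on a parity class -/

/-- `∑_{U ⊆ R} (|U| + p) = 0` in `𝔽₂` once `|R| ≥ 2`. [folklore] -/
private theorem sum_powerset_card_add (R : Finset ι) (p : ZMod 2) (hR : 2 ≤ R.card) :
    ∑ U ∈ R.powerset, ((U.card : ZMod 2) + p) = 0 := by
  obtain ⟨a, ha⟩ : R.Nonempty := card_pos.1 (by omega)
  have hR' : R = insert a (R.erase a) := (insert_erase ha).symm
  have hne : (R.erase a).Nonempty := by
    rw [← card_pos, card_erase_of_mem ha]; omega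
  rw [hR', sum_powerset_insert (notMem_erase a R)]
  have hshift : ∀ U ∈ (R.erase a).powerset,
      (((insert a U).card : ZMod 2) + p) = ((U.card : ZMod 2) + p) + 1 := by
    intro U hU
    have haU : a ∉ U := fun h => notMem_erase a R (mem_powerset.1 hU h)
    rw [card_insert_of_notMem haU, Nat.cast_add, Nat.cast_one]; ring
  rw [sum_congr rfl hshift]
  simp only [sum_add_distrib]
  have e3 : ∀ x y z : ZMod 2, x + y + (x + y + z) = z := by decide
  rw [e3, sum_const, card_powerset, nsmul_eq_mul, mul_one, Nat.cast_pow,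
    show ((2 : ℕ) : ZMod 2) = 0 by decide]
  exact zero_pow (card_pos.2 hne).ne'

/-- **Local Boolean functions vanishing on a parity class are multiples of parity.**  Let `loc` be down-closed
with `loc ∅`; let the Möbius coefficients of `f` vanish off `loc`, let `f` vanish on the parity class `π`, let
every `loc` set `S` have an isolating element `k ∉ S` (the only `loc` subset of `S ∪ {k}` through `k` is `{k}`), and
let all singleton coefficients equal `α`.  Then `f T = α · (|T| + π)` for every `T`.
[cite: Carlet2020, §2.2.1 Theorem 1 eq. (2.4) (Möbius inversion; consequence supplied here)] -/
theorem eq_mul_parity_of_local (f : Finset ι → ZMod 2) (loc : Finset ι → Prop) (π : ℕ)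
    (hdown : ∀ R S, R ⊆ S → loc S → loc R) (h0 : loc ∅)
    (hloc : ∀ S, ¬ loc S → moeb f S = 0) (hvan : ∀ T : Finset ι, (T.card : ZMod 2) = π → f T = 0)
    (hiso : ∀ S, loc S → ∃ k, k ∉ S ∧ ∀ R, loc R → k ∈ R → R ⊆ insert k S → R = {k})
    (α : ZMod 2) (hα : ∀ k, moeb f {k} = α) :
    ∀ T : Finset ι, f T = α * ((T.card : ZMod 2) + π) := by
  set a := moeb f with ha
  have ne_iff : ∀ x y : ZMod 2, x ≠ y ↔ x = y + 1 := by decide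
  -- Step 1: the formula on local sets
  have hlocal : ∀ S, loc S → f S = α * ((S.card : ZMod 2) + π) := by
    intro S hS
    by_cases hpar : (S.card : ZMod 2) = π
    · rw [hvan S hpar, hpar, add_self_zmod2, mul_zero]
    · obtain ⟨k, hkS, hk⟩ := hiso S hS
      have h1 : f (insert k S) = 0 := by
        refine hvan _ ?_
        rw [card_insert_of_notMem hkS, Nat.cast_add, Nat.cast_one, (ne_iff _ _).1 hpar, add_assoc,
          add_self_zmod2, add_zero]
      rw [← moeb_moeb f (insert k S), moeb_insert _ hkS, moeb_moeb] at h1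
      have e : moeb (fun R => a (insert k R)) S = a {k} := by
        rw [moeb_eq_apply_empty]
        · rfl
        · intro R hRS hne
          refine hloc _ fun hl => hne ?_
          have h := hk _ hl (mem_insert_self _ _) (insert_subset_insert k hRS)
          exact eq_empty_of_forall_notMem fun r hr => by
            have : r ∈ ({k} : Finset ι) := h ▸ mem_insert_of_mem hr
            rw [mem_singleton] at this; exact hkS (this ▸ hRS hr)
      rw [e, hα] at h1
      have e2 : ∀ x : ZMod 2, x + 1 + x = 1 := by decide
      rw [eq_of_add_eq_zero h1, (ne_iff _ _).1 hpar, e2, mul_one]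
  -- Step 2: coefficients of sets with at least two elements vanish
  have htwo : ∀ R : Finset ι, 2 ≤ R.card → a R = 0 := by
    intro R hR
    by_cases hl : loc R
    · show moeb f R = 0
      unfold moeb
      rw [sum_congr rfl fun U hU => hlocal U (hdown U R (mem_powerset.1 hU) hl), ← mul_sum,
        sum_powerset_card_add R _ hR, mul_zero]
    · exact hloc R hl
  -- Step 3: resum
  have hempty : a ∅ = α * (π : ZMod 2) := by
    show moeb f ∅ = _; rw [moeb_empty, hlocal ∅ h0, card_empty, Nat.cast_zero, zero_add]
  have hsum : ∀ T : Finset ι, moeb a T = a ∅ + ∑ k ∈ T, a {k} := by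
    intro T
    induction T using Finset.induction_on with
    | empty => rw [moeb_empty, sum_empty, add_zero]
    | @insert t T ht ih =>
      rw [moeb_insert _ ht, ih, sum_insert ht]
      have e : moeb (fun R => a (insert t R)) T = a {t} := by
        rw [moeb_eq_apply_empty]
        · rfl
        · intro R hRT hne
          refine htwo _ ?_
          obtain ⟨r, hr⟩ := nonempty_iff_ne_empty.2 hne
          have htR : t ∉ R := fun h => ht (hRT h)
          rw [card_insert_of_notMem htR]
          have := card_pos.2 ⟨r, hr⟩; omega
      rw [e]; abel
  intro T
  rw [← moeb_moeb f T, hsum T, hempty, sum_congr rfl fun k _ => hα k, sum_const, nsmul_eq_mul]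
  ring

end ParityClassLocal

end Literature.Computability.MetaComplexity
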